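import Summits.NavierStokesRegularity.FunctionalMining.VorticityMomentHolder
import Summits.NavierStokesRegularity.FunctionalMining.NonlinearPoincareRpow
import HarnessLib

/-!
# FunctionalMining — K0 rows `E.q|T_LD|G1` at REAL `q`: top node and static production bound

Search for candidate a priori estimates; no regularity claim. Cell `pub-nsfunc`, prove seat
(gen 9). The exponent bookkeeping of SIEVELD §3.2 (Theorem G) at a real `q > 2`, fed with the
five static inputs of `VorticityMomentHolder` and the top node `A_{3q} ≤ C_T I³` proved here
(§0: `∫‖u‖^{6a+6} ≤ 32(C₆(1+a)⁶ + C_NP³)(∫‖u‖^{2a}∑ₖ‖∂ₖu‖²)³` for zero-mean `u` on `T³`, any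
`a > 0`, by mean-zero Sobolev on the regularisation `W_ε` minus its mean, the mean bounded through
the nonlinear Poincaré inequality `NonlinearPoincareRpow`, `ε → 0⁺` by continuity; `a = (q−2)/2`),
at every real `q > 2`: for smooth divergence-free `v` on `T³`, `ω = curl v`,
`F = ∫‖ω‖^q`, `Z = ∫‖ω‖²`, `I = ∫‖ω‖^{q−2}∑ₖ‖∂ₖω‖²`, `X = ∫(|ω|²)^{q/2−1}σ`:

`|X| ≤ C · I^{a} · (Z · F^{1+1/σ})^{1−a}`, `a = (3q−3)/(5q−6) = γ/(1+γ)`, `σ = 2q−3`, `γ = (3q−3)/(2q−3)`,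

the split at which Young against `−qνI` yields `Ż_q ≤ κν^{−γ}ZF^{1+1/σ}` (sequel). Chain:
`|X| ≤ √2 F^{(q−1)/q}G^{1/q}`, `G ≤ K A_{2q}`, `A_{2q}² ≤ F A_{3q}`, `F^λ ≤ Z^{λθ}A_{3q}^{λ(1−θ)}`
(`θ = 2q/(3q−2)`, `λ = (2q−3)(3q−2)/(2q(5q−6))`: "moving weight outward"), `A_{3q} ≤ C_T I³`; the
exponent identities `θλ = (2q−3)/(5q−6) = 1 − a`, `(1−θ)λ + 1/(2q) = a/3`,
`(2q−1)/(2q) − λ = (2q−2)/(5q−6) = (1 + 1/σ)(1 − a)` are the two conservation laws (homogeneity in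
the amplitude and in the length scale) of SIEVELD §3.2.

## Main statements

* `NonlinearPoincare.integral_norm_rpow_top_le` — the top node at a real parameter.
* `production_rpow_bookkeeping` — the exponent bookkeeping as a real-variable lemma.
* `production_rpow_bound` — `|X| ≤ C I^a (Z F^{1+1/σ})^{1−a}` on `T³` for real `q > 2`.
-/

noncomputable section

open MeasureTheory Finset Set
open scoped InnerProductSpace RealInnerProductSpace ContDiff

namespace Summit.NavierStokesRegularity.FunctionalMining

open Literature.Analysis.FunctionSpaces Literature.Analysis.FunctionSpaces.Torus
  Literature.Analysis.FluidPDE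

namespace NonlinearPoincare

variable {d : Type*} [Fintype d] [DecidableEq d]

omit [Fintype d] [DecidableEq d] in
/-- `(a + b)⁶ ≤ 32 (a⁶ + b⁶)`. [folklore] -/
private theorem add_pow_six_le (a b : ℝ) : (a + b) ^ 6 ≤ 32 * (a ^ 6 + b ^ 6) := by
  have h1 : (a + b) ^ 2 ≤ 2 * (a ^ 2 + b ^ 2) := by nlinarith [sq_nonneg (a - b)]
  have h2 : ∀ {p q : ℝ}, 0 ≤ p → 0 ≤ q → (p + q) ^ 3 ≤ 4 * (p ^ 3 + q ^ 3) := by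
    intro p q hp hq; nlinarith [sq_nonneg (p - q), mul_nonneg hp hq]
  calc (a + b) ^ 6 = ((a + b) ^ 2) ^ 3 := by ring
    _ ≤ (2 * (a ^ 2 + b ^ 2)) ^ 3 := pow_le_pow_left₀ (by positivity) h1 3
    _ = 8 * (a ^ 2 + b ^ 2) ^ 3 := by ring
    _ ≤ 8 * (4 * ((a ^ 2) ^ 3 + (b ^ 2) ^ 3)) :=
        mul_le_mul_of_nonneg_left (h2 (sq_nonneg a) (sq_nonneg b)) (by norm_num)
    _ = 32 * (a ^ 6 + b ^ 6) := by ring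

/-- **Top node at a real parameter `a > 0`.** Given a mean-zero Sobolev constant `C₆`
(`∫‖v‖⁶ ≤ C₆ ‖∇v‖₂⁶`; on `T³` from `Torus.exists_integral_norm_pow_six_le_gradNormSq_cube`), for
every smooth zero-mean `u` on `T^d`:
`∫‖u‖^{6a+6} ≤ 32 (C₆ (1+a)⁶ + C_NP³) (∫‖u‖^{2a}∑ₖ‖∂ₖu‖²)³`, `C_NP = 6(1 + (3^{1+a})²)(1+a)² d³`.
[ours] -/
theorem integral_norm_rpow_top_le {C₆ : ℝ} (hC₆0 : 0 ≤ C₆)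
    (hC₆ : ∀ v : UnitAddTorus d → EuclideanSpace ℝ d, IsSmooth v → HasZeroMean v →
      ∫ x, ‖v x‖ ^ 6 ≤ C₆ * gradNormSq v ^ 3)
    {u : UnitAddTorus d → EuclideanSpace ℝ d} (hu : IsSmooth u) (h0 : HasZeroMean u)
    {a : ℝ} (ha : 0 < a) :
    ∫ x, ‖u x‖ ^ (6 * a + 6) ≤
      32 * (C₆ * (1 + a) ^ 6 +
          (6 * (1 + ((3 : ℝ) ^ (1 + a)) ^ 2) * (1 + a) ^ 2 * (Fintype.card d : ℝ) ^ 3) ^ 3) *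
        (∫ x, ‖u x‖ ^ (2 * a) * ∑ k, ‖partialDeriv k u x‖ ^ 2) ^ 3 := by
  obtain ⟨I, hI⟩ : ∃ I : ℝ, I = ∫ x, ‖u x‖ ^ (2 * a) * ∑ k, ‖partialDeriv k u x‖ ^ 2 := ⟨_, rfl⟩
  obtain ⟨CNP, hCNP⟩ : ∃ C : ℝ,
      C = 6 * (1 + ((3 : ℝ) ^ (1 + a)) ^ 2) * (1 + a) ^ 2 * (Fintype.card d : ℝ) ^ 3 := ⟨_, rfl⟩
  rw [← hI, ← hCNP]
  have huc : Continuous u := hu.continuous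
  have hcs : Continuous fun x => ∑ k, ‖partialDeriv k u x‖ ^ 2 :=
    continuous_finsetSum _ fun k _ => (hu.partialDeriv k).continuous.norm.pow 2
  have hcs0 : ∀ x, 0 ≤ ∑ k, ‖partialDeriv k u x‖ ^ 2 := fun x =>
    Finset.sum_nonneg fun k _ => sq_nonneg _
  have hI0 : 0 ≤ I := by
    rw [hI]; exact integral_nonneg fun x => mul_nonneg (Real.rpow_nonneg (norm_nonneg _) _) (hcs0 x)
  have hCNP0 : 0 ≤ CNP := by rw [hCNP]; positivity
  -- the two parametric integrals
  set J : ℝ → ℝ := fun ε => ∫ x, (‖u x‖ ^ 2 + ε) ^ a * ∑ k, ‖partialDeriv k u x‖ ^ 2 with hJ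
  set L : ℝ → ℝ := fun ε => ∫ x, (‖u x‖ ^ 2 + ε) ^ a * ‖u x‖ ^ 2 with hL
  have hNP : L 0 ≤ CNP * I := by
    have h := integral_norm_rpow_le_weighted hu h0 ha
    rw [← hI, ← hCNP] at h
    have e : L 0 = ∫ x, ‖u x‖ ^ (2 * a + 2) := by
      simp only [hL, add_zero]
      refine integral_congr_ae (ae_of_all _ fun x => ?_)
      show (‖u x‖ ^ 2) ^ a * ‖u x‖ ^ 2 = ‖u x‖ ^ (2 * a + 2)
      have hn : 0 ≤ ‖u x‖ := norm_nonneg _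
      have e1 : (‖u x‖ ^ 2) ^ a = ‖u x‖ ^ (2 * a) := by
        rw [← Real.rpow_natCast, ← Real.rpow_mul hn]; norm_num
      rw [e1]
      rcases eq_or_lt_of_le hn with hz | hpos
      · rw [← hz, Real.zero_rpow (by linarith), Real.zero_rpow (by linarith)]; simp
      · rw [← Real.rpow_natCast ‖u x‖ 2, ← Real.rpow_add hpos]; norm_num
    rw [e]; exact h
  have hJ0 : J 0 = I := by
    simp only [hJ, hI, add_zero]
    refine integral_congr_ae (ae_of_all _ fun x => ?_)
    have : (‖u x‖ ^ 2) ^ a = ‖u x‖ ^ (2 * a) := by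
      rw [← Real.rpow_natCast, ← Real.rpow_mul (norm_nonneg _)]; norm_num
    simp only [this]
  have hL00 : 0 ≤ L 0 := by
    simp only [hL]
    exact integral_nonneg fun x => mul_nonneg (Real.rpow_nonneg (by positivity) _) (sq_nonneg _)
  -- for every `0 < ε ≤ 1`
  have hε : ∀ ε : ℝ, 0 < ε → ε ≤ 1 →
      ∫ x, ‖u x‖ ^ (6 * a + 6) ≤ 32 * (C₆ * ((1 + a) ^ 2 * J ε) ^ 3 + L ε ^ 3) := by
    intro ε hε _
    set Wε : UnitAddTorus d → EuclideanSpace ℝ d := fun x => (‖u x‖ ^ 2 + ε) ^ (a / 2) • u x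
      with hWε
    set cε : EuclideanSpace ℝ d := ∫ x, Wε x with hcε
    have hWεs : IsSmooth Wε := isSmooth_regA hu hε (a / 2)
    have hWεc : Continuous Wε := hWεs.continuous
    have hpos : ∀ x, 0 < ‖u x‖ ^ 2 + ε := fun x => by positivity
    -- `‖Wε x‖² = (‖u‖²+ε)^a ‖u‖²`
    have hnormsq : ∀ x, ‖Wε x‖ ^ 2 = (‖u x‖ ^ 2 + ε) ^ a * ‖u x‖ ^ 2 := by
      intro x
      simp only [hWε]
      rw [norm_smul, Real.norm_of_nonneg (Real.rpow_nonneg (hpos x).le _), mul_pow,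
        ← Real.rpow_natCast ((‖u x‖ ^ 2 + ε) ^ (a / 2)), ← Real.rpow_mul (hpos x).le]
      norm_num
    -- Sobolev for `Wε − cε`
    have hsm : IsSmooth (fun x => Wε x - cε) := hWεs.sub (isSmooth_const cε)
    have hzm : HasZeroMean (fun x => Wε x - cε) := by
      show ∫ x, (Wε x - cε) = 0
      rw [integral_sub hWεc.integrable_unitAddTorus (integrable_const _), integral_const, hcε]
      simp
    have hS := hC₆ _ hsm hzm
    have hg : gradNormSq (fun x => Wε x - cε) = gradNormSq Wε := by
      unfold gradNormSq
      refine integral_congr_ae (ae_of_all _ fun x => ?_)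
      refine Finset.sum_congr rfl fun k _ => ?_
      have e : (fun x => Wε x - cε) = Wε + fun _ => -cε := by
        funext y; simp [sub_eq_add_neg]
      have hcst : IsContDiff 1 (fun _ : UnitAddTorus d => -cε) := contDiff_const
      have hz : partialDeriv k (fun _ : UnitAddTorus d => -cε) x = 0 := by
        simp [Torus.partialDeriv, Torus.lineDeriv]
      rw [e, partialDeriv_add (hWεs.isContDiff (by simp)) hcst, Pi.add_apply, hz, add_zero]
    have hG : gradNormSq Wε ≤ (1 + a) ^ 2 * J ε := gradNormSq_regA_le hu ha.le hε
    have hG0 : 0 ≤ gradNormSq Wε := gradNormSq_nonneg _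
    have hS' : ∫ x, ‖Wε x - cε‖ ^ 6 ≤ C₆ * ((1 + a) ^ 2 * J ε) ^ 3 := by
      calc ∫ x, ‖Wε x - cε‖ ^ 6 ≤ C₆ * gradNormSq (fun x => Wε x - cε) ^ 3 := hS
        _ = C₆ * gradNormSq Wε ^ 3 := by rw [hg]
        _ ≤ C₆ * ((1 + a) ^ 2 * J ε) ^ 3 := by gcongr
    -- the mean: `‖cε‖⁶ ≤ (L ε)³`
    have hLε : ∫ x, ‖Wε x‖ ^ 2 = L ε := by
      simp only [hL]; exact integral_congr_ae (ae_of_all _ hnormsq)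
    have hLε0 : 0 ≤ L ε := by rw [← hLε]; exact integral_nonneg fun x => sq_nonneg _
    have hc6 : ‖cε‖ ^ 6 ≤ L ε ^ 3 := by
      have h1 : ‖cε‖ ≤ ∫ x, ‖Wε x‖ := norm_integral_le_integral_norm _
      have h2 : ∫ x, ‖Wε x‖ ≤ Real.sqrt (∫ x, ‖Wε x‖ ^ 2) :=
        VelocityL4.integral_le_sqrt_integral_sq hWεc.norm
      rw [hLε] at h2
      calc ‖cε‖ ^ 6 ≤ Real.sqrt (L ε) ^ 6 := pow_le_pow_left₀ (norm_nonneg _) (h1.trans h2) 6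
        _ = (Real.sqrt (L ε) ^ 2) ^ 3 := by ring
        _ = L ε ^ 3 := by rw [Real.sq_sqrt hLε0]
    -- pointwise `‖u‖^{6a+6} ≤ ‖Wε‖⁶ ≤ 32(‖Wε − cε‖⁶ + ‖cε‖⁶)`
    have hpt : ∀ x, ‖u x‖ ^ (6 * a + 6) ≤ 32 * (‖Wε x - cε‖ ^ 6 + ‖cε‖ ^ 6) := by
      intro x
      have hn : 0 ≤ ‖u x‖ := norm_nonneg _
      have hW1 : ‖u x‖ ^ (a + 1) ≤ ‖Wε x‖ := by
        simp only [hWε]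
        rw [norm_smul, Real.norm_of_nonneg (Real.rpow_nonneg (hpos x).le _)]
        have e1 : (‖u x‖ ^ 2) ^ (a / 2) = ‖u x‖ ^ a := by
          rw [← Real.rpow_natCast, ← Real.rpow_mul hn]
          congr 1
          push_cast
          ring
        have hmono : ‖u x‖ ^ a ≤ (‖u x‖ ^ 2 + ε) ^ (a / 2) := by
          rw [← e1]; exact Real.rpow_le_rpow (sq_nonneg _) (by linarith) (by positivity)
        rcases eq_or_lt_of_le hn with hz | hp
        · rw [← hz, Real.zero_rpow (by linarith)]; simp
        · calc ‖u x‖ ^ (a + 1) = ‖u x‖ ^ a * ‖u x‖ := by rw [Real.rpow_add hp, Real.rpow_one]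
            _ ≤ (‖u x‖ ^ 2 + ε) ^ (a / 2) * ‖u x‖ := mul_le_mul_of_nonneg_right hmono hn
      have e6 : ‖u x‖ ^ (6 * a + 6) = (‖u x‖ ^ (a + 1)) ^ 6 := by
        rw [← Real.rpow_natCast (‖u x‖ ^ (a + 1)), ← Real.rpow_mul hn]
        congr 1
        push_cast
        ring
      have h6 : (‖u x‖ ^ (a + 1)) ^ 6 ≤ ‖Wε x‖ ^ 6 :=
        pow_le_pow_left₀ (Real.rpow_nonneg hn _) hW1 6
      have hsplit : ‖Wε x‖ ^ 6 ≤ 32 * (‖Wε x - cε‖ ^ 6 + ‖cε‖ ^ 6) := by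
        have h := norm_add_le (Wε x - cε) cε
        rw [sub_add_cancel] at h
        exact (pow_le_pow_left₀ (norm_nonneg _) h 6).trans (add_pow_six_le _ _)
      rw [e6]; exact h6.trans hsplit
    have hi1 : Integrable (fun x => ‖Wε x - cε‖ ^ 6) volume :=
      ((hWεc.sub continuous_const).norm.pow 6).integrable_unitAddTorus
    have hi2 : Integrable (fun _ : UnitAddTorus d => ‖cε‖ ^ 6) volume := integrable_const _
    have hcu : Continuous fun x => ‖u x‖ ^ (6 * a + 6) :=
      huc.norm.rpow_const fun _ => Or.inr (by positivity)
    calc ∫ x, ‖u x‖ ^ (6 * a + 6) ≤ ∫ x, 32 * (‖Wε x - cε‖ ^ 6 + ‖cε‖ ^ 6) :=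
          integral_mono hcu.integrable_unitAddTorus ((hi1.add hi2).const_mul 32) hpt
      _ = 32 * ((∫ x, ‖Wε x - cε‖ ^ 6) + ‖cε‖ ^ 6) := by
          rw [integral_const_mul, integral_add hi1 hi2, integral_const]; simp
      _ ≤ 32 * (C₆ * ((1 + a) ^ 2 * J ε) ^ 3 + L ε ^ 3) := by
          gcongr
  -- `ε → 0⁺`
  have hJc : Continuous J := by
    refine continuous_integral_param ?_
    have h1 : Continuous fun p : ℝ × UnitAddTorus d => (‖u p.2‖ ^ 2 + p.1) ^ a :=
      (((huc.comp continuous_snd).norm.pow 2).add continuous_fst).rpow_const fun _ => Or.inr ha.le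
    exact h1.mul (hcs.comp continuous_snd)
  have hLc : Continuous L := by
    refine continuous_integral_param ?_
    have h1 : Continuous fun p : ℝ × UnitAddTorus d => (‖u p.2‖ ^ 2 + p.1) ^ a :=
      (((huc.comp continuous_snd).norm.pow 2).add continuous_fst).rpow_const fun _ => Or.inr ha.le
    exact h1.mul ((huc.comp continuous_snd).norm.pow 2)
  have hφc : ContinuousAt (fun ε : ℝ => 32 * (C₆ * ((1 + a) ^ 2 * J ε) ^ 3 + L ε ^ 3)) 0 :=
    ((((hJc.continuousAt.const_mul _).pow 3).const_mul C₆).add (hLc.continuousAt.pow 3)).const_mul 32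
  have hmain := le_of_forall_pos_le_of_continuousAt hφc hε
  rw [hJ0] at hmain
  have hL3 : L 0 ^ 3 ≤ (CNP * I) ^ 3 := pow_le_pow_left₀ hL00 hNP 3
  calc ∫ x, ‖u x‖ ^ (6 * a + 6) ≤ 32 * (C₆ * ((1 + a) ^ 2 * I) ^ 3 + L 0 ^ 3) := hmain
    _ ≤ 32 * (C₆ * ((1 + a) ^ 2 * I) ^ 3 + (CNP * I) ^ 3) := by gcongr
    _ = 32 * (C₆ * (1 + a) ^ 6 + CNP ^ 3) * I ^ 3 := by ring

end NonlinearPoincare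

namespace VorticityMoment

open VorticityL4 NonlinearPoincare

/-! ## 1. Exponent bookkeeping -/

/-- **Exponent bookkeeping of SIEVELD §3.2 at a real `q > 2`.** For non-negative reals with
`X ≤ √2 F^{(q−1)/q} G^{1/q}`, `G ≤ K A₂`, `A₂² ≤ F A`, `A ≤ T`, `F ≤ Z^θ A^{1−θ}`
(`θ = 2q/(3q−2)`): `X ≤ √2 K^{1/q} T^{a/3} (Z F^{1+1/(2q−3)})^{1−a}`, `a = (3q−3)/(5q−6)`.
[ours; elementary] -/
theorem production_rpow_bookkeeping {q X F G A₂ A T Z K : ℝ} (hq : 2 < q) (hF : 0 ≤ F)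
    (hG : 0 ≤ G) (hA₂ : 0 ≤ A₂) (hA : 0 ≤ A) (hZ : 0 ≤ Z) (hK : 0 ≤ K)
    (h1 : X ≤ Real.sqrt 2 * (F ^ ((q - 1) / q) * G ^ (1 / q))) (h2 : G ≤ K * A₂)
    (h3 : A₂ ^ 2 ≤ F * A) (h4 : A ≤ T)
    (h5 : F ≤ Z ^ (2 * q / (3 * q - 2)) * A ^ (1 - 2 * q / (3 * q - 2))) :
    X ≤ Real.sqrt 2 * K ^ (1 / q) * T ^ ((3 * q - 3) / (5 * q - 6) / 3) *
      (Z * F ^ (1 + (2 * q - 3)⁻¹)) ^ (1 - (3 * q - 3) / (5 * q - 6)) := by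
  -- nonvanishing denominators (both syntactic forms, for `field_simp`)
  have hq0 : q ≠ 0 := by intro h; linarith
  have h32 : 3 * q - 2 ≠ 0 := by intro h; linarith
  have h32' : q * 3 - 2 ≠ 0 := by intro h; linarith
  have h56 : 5 * q - 6 ≠ 0 := by intro h; linarith
  have h56' : q * 5 - 6 ≠ 0 := by intro h; linarith
  have h23 : 2 * q - 3 ≠ 0 := by intro h; linarith
  have h23' : q * 2 - 3 ≠ 0 := by intro h; linarith
  have hT : 0 ≤ T := hA.trans h4
  -- the exponents
  obtain ⟨θ, hθ⟩ : ∃ θ : ℝ, θ = 2 * q / (3 * q - 2) := ⟨_, rfl⟩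
  obtain ⟨l, hl⟩ : ∃ l : ℝ, l = (2 * q - 3) * (3 * q - 2) / (2 * q * (5 * q - 6)) := ⟨_, rfl⟩
  obtain ⟨a, ha⟩ : ∃ a : ℝ, a = (3 * q - 3) / (5 * q - 6) := ⟨_, rfl⟩
  obtain ⟨b, hb⟩ : ∃ b : ℝ, b = (2 * q - 3) / (5 * q - 6) := ⟨_, rfl⟩
  obtain ⟨c, hc⟩ : ∃ c : ℝ, c = (2 * q - 2) / (5 * q - 6) := ⟨_, rfl⟩
  rw [← hθ] at h5
  rw [← ha]
  have hθ0 : 0 < θ := by rw [hθ]; exact div_pos (by linarith) (by linarith)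
  have hθ1 : θ < 1 := by rw [hθ, div_lt_one (by linarith)]; linarith
  have hl0 : 0 < l := by
    rw [hl]; exact div_pos (mul_pos (by linarith) (by linarith)) (mul_pos (by linarith) (by linarith))
  have ha0 : 0 < a := by rw [ha]; exact div_pos (by linarith) (by linarith)
  have hb0 : 0 < b := by rw [hb]; exact div_pos (by linarith) (by linarith)
  have hc0 : 0 < c := by rw [hc]; exact div_pos (by linarith) (by linarith)
  -- the five identities
  have i1 : c + l = (q - 1) / q + 1 / (2 * q) := by rw [hc, hl]; field_simp; ring
  have i2 : θ * l = b := by rw [hθ, hl, hb]; field_simp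
  have i3 : (1 - θ) * l + 1 / (2 * q) = a / 3 := by rw [hθ, hl, ha]; field_simp; ring
  have i4 : b = 1 - a := by rw [hb, ha]; field_simp; ring
  have i5 : c = (1 + (2 * q - 3)⁻¹) * (1 - a) := by
    have e : 1 + (2 * q - 3)⁻¹ = (2 * q - 2) / (2 * q - 3) := by
      rw [inv_eq_one_div, one_add_div h23]; ring
    rw [e, ← i4, hb, hc, div_mul_div_comm, mul_comm (2 * q - 2) (2 * q - 3),
      mul_div_mul_left _ _ h23]
  -- step 1: `G^{1/q} ≤ K^{1/q} A₂^{1/q}`, `A₂^{1/q} ≤ F^{1/(2q)} A^{1/(2q)}`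
  have hq1 : 0 ≤ 1 / q := by positivity
  have s1 : G ^ (1 / q) ≤ K ^ (1 / q) * A₂ ^ (1 / q) := by
    rw [← Real.mul_rpow hK hA₂]; exact Real.rpow_le_rpow hG h2 hq1
  have s2 : A₂ ^ (1 / q) ≤ F ^ (1 / (2 * q)) * A ^ (1 / (2 * q)) := by
    have h3' : A₂ ≤ (F * A) ^ (1 / 2 : ℝ) := by
      have e : (A₂ ^ 2) ^ (1 / 2 : ℝ) = A₂ := by
        rw [← Real.rpow_natCast, ← Real.rpow_mul hA₂]; norm_num
      rw [← e]; exact Real.rpow_le_rpow (sq_nonneg _) h3 (by norm_num)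
    have h3'' := Real.rpow_le_rpow hA₂ h3' hq1
    rw [← Real.rpow_mul (mul_nonneg hF hA), Real.mul_rpow hF hA,
      show (1 / 2 : ℝ) * (1 / q) = 1 / (2 * q) by field_simp] at h3''
    exact h3''
  -- step 2: `X ≤ √2 K^{1/q} F^{c} F^{l} A^{1/(2q)}`
  have s3 : X ≤ Real.sqrt 2 * K ^ (1 / q) * (F ^ c * F ^ l * A ^ (1 / (2 * q))) := by
    have e1 : F ^ ((q - 1) / q) * F ^ (1 / (2 * q)) = F ^ c * F ^ l := by
      rw [← Real.rpow_add' hF (by rw [← i1]; linarith), ← i1, Real.rpow_add' hF (by linarith)]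
    calc X ≤ Real.sqrt 2 * (F ^ ((q - 1) / q) * G ^ (1 / q)) := h1
      _ ≤ Real.sqrt 2 * (F ^ ((q - 1) / q) * (K ^ (1 / q) * (F ^ (1 / (2 * q)) * A ^ (1 / (2 * q))))) :=
          mul_le_mul_of_nonneg_left (mul_le_mul_of_nonneg_left
            (s1.trans (mul_le_mul_of_nonneg_left s2 (Real.rpow_nonneg hK _))) (Real.rpow_nonneg hF _))
            (Real.sqrt_nonneg 2)
      _ = Real.sqrt 2 * K ^ (1 / q) * ((F ^ ((q - 1) / q) * F ^ (1 / (2 * q))) * A ^ (1 / (2 * q))) := by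
          ring
      _ = Real.sqrt 2 * K ^ (1 / q) * (F ^ c * F ^ l * A ^ (1 / (2 * q))) := by rw [e1]
  -- step 3: `F^l ≤ Z^{b} A^{(1-θ) l}` and the `A`-powers collect to `A^{a/3} ≤ T^{a/3}`
  have s4 : F ^ l ≤ Z ^ b * A ^ ((1 - θ) * l) := by
    have h := Real.rpow_le_rpow hF h5 hl0.le
    rw [Real.mul_rpow (Real.rpow_nonneg hZ _) (Real.rpow_nonneg hA _), ← Real.rpow_mul hZ,
      ← Real.rpow_mul hA, i2] at h
    exact h
  have s5 : A ^ ((1 - θ) * l) * A ^ (1 / (2 * q)) = A ^ (a / 3) := by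
    rw [← Real.rpow_add' hA (by rw [i3]; positivity), i3]
  have s6 : A ^ (a / 3) ≤ T ^ (a / 3) := Real.rpow_le_rpow hA h4 (by positivity)
  have s7 : F ^ c * F ^ l * A ^ (1 / (2 * q)) ≤ F ^ c * Z ^ b * T ^ (a / 3) := by
    calc F ^ c * F ^ l * A ^ (1 / (2 * q))
        ≤ F ^ c * (Z ^ b * A ^ ((1 - θ) * l)) * A ^ (1 / (2 * q)) :=
          mul_le_mul_of_nonneg_right (mul_le_mul_of_nonneg_left s4 (Real.rpow_nonneg hF _))
            (Real.rpow_nonneg hA _)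
      _ = F ^ c * Z ^ b * (A ^ ((1 - θ) * l) * A ^ (1 / (2 * q))) := by ring
      _ = F ^ c * Z ^ b * A ^ (a / 3) := by rw [s5]
      _ ≤ F ^ c * Z ^ b * T ^ (a / 3) :=
          mul_le_mul_of_nonneg_left s6 (mul_nonneg (Real.rpow_nonneg hF _) (Real.rpow_nonneg hZ _))
  -- step 4: `F^c Z^b = (Z F^{1+1/σ})^{1-a}`
  have s8 : F ^ c * Z ^ b = (Z * F ^ (1 + (2 * q - 3)⁻¹)) ^ (1 - a) := by
    rw [Real.mul_rpow hZ (Real.rpow_nonneg hF _), ← Real.rpow_mul hF, ← i5, ← i4, mul_comm]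
  calc X ≤ Real.sqrt 2 * K ^ (1 / q) * (F ^ c * F ^ l * A ^ (1 / (2 * q))) := s3
    _ ≤ Real.sqrt 2 * K ^ (1 / q) * (F ^ c * Z ^ b * T ^ (a / 3)) :=
        mul_le_mul_of_nonneg_left s7 (mul_nonneg (Real.sqrt_nonneg _) (Real.rpow_nonneg hK _))
    _ = Real.sqrt 2 * K ^ (1 / q) * T ^ (a / 3) * (F ^ c * Z ^ b) := by ring
    _ = Real.sqrt 2 * K ^ (1 / q) * T ^ (a / 3) * (Z * F ^ (1 + (2 * q - 3)⁻¹)) ^ (1 - a) := by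
        rw [s8]

/-! ## 2. The static production bound on `T³` -/

/-- **Production bound (static, `T³`, real `q > 2`).** With the tree's mean-zero Sobolev
constant `C₆` and a Calderón–Zygmund constant `K` at `s = 2q` (`∫(∑ₖ‖∂ₖv‖²)^q ≤ K∫‖curl v‖^{2q}`):
for every smooth divergence-free `v` on `T³`, `ω = curl v`,
`|∫(|ω|²)^{q/2−1}σ| ≤ √2 K^{1/q} C_T^{a/3} · (∫‖ω‖^{q−2}∑ₖ‖∂ₖω‖²)^a · (∫‖ω‖² · (∫‖ω‖^q)^{1+1/(2q−3)})^{1−a}`,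
`a = (3q−3)/(5q−6)`, `C_T = 32(C₆(1+ā)⁶ + (6(1+(3^{1+ā})²)(1+ā)²·27)³)`, `ā = (q−2)/2`. [ours] -/
theorem production_rpow_bound {C₆ K q : ℝ} (hC₆0 : 0 ≤ C₆) (hK0 : 0 ≤ K) (hq : 2 < q)
    (hC₆ : ∀ w : UnitAddTorus (Fin 3) → EuclideanSpace ℝ (Fin 3), IsSmooth w → HasZeroMean w →
      ∫ x, ‖w x‖ ^ 6 ≤ C₆ * gradNormSq w ^ 3)
    (hK : ∀ w : UnitAddTorus (Fin 3) → EuclideanSpace ℝ (Fin 3), IsSmooth w → IsDivFree w →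
      ∫ x, (∑ k, ‖partialDeriv k w x‖ ^ 2) ^ q ≤ K * ∫ x, ‖BDSV.curl w x‖ ^ (2 * q))
    {v : UnitAddTorus (Fin 3) → EuclideanSpace ℝ (Fin 3)} (hv : IsSmooth v) (hdiv : IsDivFree v) :
    |∫ x, torusVorticitySqAt v x ^ (q / 2 - 1) * torusStretchingDensity v x| ≤
      Real.sqrt 2 * K ^ (1 / q) *
        (32 * (C₆ * (1 + (q - 2) / 2) ^ 6 +
          (6 * (1 + ((3 : ℝ) ^ (1 + (q - 2) / 2)) ^ 2) * (1 + (q - 2) / 2) ^ 2 *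
            (Fintype.card (Fin 3) : ℝ) ^ 3) ^ 3) *
          (∫ x, ‖BDSV.curl v x‖ ^ (q - 2) * ∑ k, ‖partialDeriv k (BDSV.curl v) x‖ ^ 2) ^ 3) ^
          ((3 * q - 3) / (5 * q - 6) / 3) *
        ((∫ x, ‖BDSV.curl v x‖ ^ (2 : ℝ)) *
          (∫ x, ‖BDSV.curl v x‖ ^ q) ^ (1 + (2 * q - 3)⁻¹)) ^ (1 - (3 * q - 3) / (5 * q - 6)) := by
  have hω : IsSmooth (BDSV.curl v) := BDSV.isSmooth_curl hv
  have h0 : HasZeroMean (BDSV.curl v) := hasZeroMean_curl hv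
  have ha : 0 < (q - 2) / 2 := by linarith
  have hg0 : ∀ x, 0 ≤ ∑ k, ‖partialDeriv k v x‖ ^ 2 := fun x =>
    Finset.sum_nonneg fun k _ => sq_nonneg _
  -- the quantities
  obtain ⟨F, hF⟩ : ∃ F : ℝ, F = ∫ x, ‖BDSV.curl v x‖ ^ q := ⟨_, rfl⟩
  obtain ⟨G, hG⟩ : ∃ G : ℝ, G = ∫ x, (∑ k, ‖partialDeriv k v x‖ ^ 2) ^ q := ⟨_, rfl⟩
  obtain ⟨A₂, hA₂⟩ : ∃ A : ℝ, A = ∫ x, ‖BDSV.curl v x‖ ^ (2 * q) := ⟨_, rfl⟩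
  obtain ⟨A, hA⟩ : ∃ A : ℝ, A = ∫ x, ‖BDSV.curl v x‖ ^ (3 * q) := ⟨_, rfl⟩
  obtain ⟨Z, hZ⟩ : ∃ Z : ℝ, Z = ∫ x, ‖BDSV.curl v x‖ ^ (2 : ℝ) := ⟨_, rfl⟩
  obtain ⟨I, hI⟩ : ∃ I : ℝ, I = ∫ x, ‖BDSV.curl v x‖ ^ (q - 2) *
      ∑ k, ‖partialDeriv k (BDSV.curl v) x‖ ^ 2 := ⟨_, rfl⟩
  obtain ⟨CT, hCT⟩ : ∃ C : ℝ, C = 32 * (C₆ * (1 + (q - 2) / 2) ^ 6 +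
      (6 * (1 + ((3 : ℝ) ^ (1 + (q - 2) / 2)) ^ 2) * (1 + (q - 2) / 2) ^ 2 *
        (Fintype.card (Fin 3) : ℝ) ^ 3) ^ 3) := ⟨_, rfl⟩
  rw [← hF, ← hZ, ← hI, ← hCT]
  have hF0 : 0 ≤ F := by rw [hF]; exact integral_nonneg fun x => Real.rpow_nonneg (norm_nonneg _) _
  have hG0 : 0 ≤ G := by rw [hG]; exact integral_nonneg fun x => Real.rpow_nonneg (hg0 x) _
  have hA₂0 : 0 ≤ A₂ := by rw [hA₂]; exact integral_nonneg fun x => Real.rpow_nonneg (norm_nonneg _) _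
  have hA0 : 0 ≤ A := by rw [hA]; exact integral_nonneg fun x => Real.rpow_nonneg (norm_nonneg _) _
  have hZ0 : 0 ≤ Z := by rw [hZ]; exact integral_nonneg fun x => Real.rpow_nonneg (norm_nonneg _) _
  -- the five inputs and the top node
  have h1 : |∫ x, torusVorticitySqAt v x ^ (q / 2 - 1) * torusStretchingDensity v x| ≤
      Real.sqrt 2 * (F ^ ((q - 1) / q) * G ^ (1 / q)) := by
    have h := abs_production_le hv hq.le
    have h' := holder_production_le hv (by linarith : 1 < q)
    rw [← hF, ← hG] at h'
    exact h.trans (mul_le_mul_of_nonneg_left h' (Real.sqrt_nonneg _))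
  have h2 : G ≤ K * A₂ := by rw [hG, hA₂]; exact hK v hv hdiv
  have h3 : A₂ ^ 2 ≤ F * A := by rw [hA₂, hF, hA]; exact moment_two_q_sq_le hv (by linarith)
  have h4 : A ≤ CT * I ^ 3 := by
    have h := integral_norm_rpow_top_le hC₆0 hC₆ hω h0 ha
    rw [show 6 * ((q - 2) / 2) + 6 = 3 * q by ring, show 2 * ((q - 2) / 2) = q - 2 by ring,
      ← hA, ← hI, ← hCT] at h
    exact h
  have h5 : F ≤ Z ^ (2 * q / (3 * q - 2)) * A ^ (1 - 2 * q / (3 * q - 2)) := by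
    rw [hF, hZ, hA]; exact moment_q_le_interp hv hq
  exact production_rpow_bookkeeping hq hF0 hG0 hA₂0 hA0 hZ0 hK0 h1 h2 h3 h4 h5

end VorticityMoment

end Summit.NavierStokesRegularity.FunctionalMining
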